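import Literature.NumberTheory.LFunctions.ZeroStatisticsPairSums
import Literature.NumberTheory.LFunctions.ZeroPairExchange
import Literature.NumberTheory.LFunctions.PairBoxRiemannSum
import Literature.NumberTheory.LFunctions.PairCountTools
import Literature.NumberTheory.LFunctions.RudnickSarnakProofs
import HarnessLib

/-!
# The `2`-level GUE hypothesis is equivalent to Montgomery's pair correlation conjecture (proved)

Trunk T-ANT (`Literature/NumberTheory/LFunctions`). Proofs only: no definitions, no named facts.
Discharge of the named fact `Literature.NumberTheory.LFunctions.gueHypothesisAt_one_iff_montgomery`
(`ZeroStatistics.lean`): `GUEHypothesisAt 1 ↔ MontgomeryPairCorrelation`, i.e. the `2`-level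
case of the GUE hypothesis (Rudnick–Sarnak, Duke Math. J. 81 (1996), §1, Remark 1: for all
test functions TF1–TF3 of two variables, `N`-indexed, normalisation `γ̃ = γ log γ / 2π`) is
equivalent to Montgomery's pair correlation conjecture (Montgomery 1973, (12), in the
`N(T)`-normalised form of Titchmarsh–Heath-Brown §14.34: closed windows
`2πα/log T ≤ γ − γ' ≤ 2πβ/log T`, limit in `T`). Rudnick–Sarnak, loc. cit.: "In the case of
`ζ(s)` and `n = 2`, Theorem 1.2 coincides with the result of Montgomery [18]"; the equivalence
of the two *conjectures* is the same bookkeeping, which we carry out in full: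

* `(→)` `montgomeryPairCorrelation_of_gueHypothesisAt_one`: the hypothesis applied to the
  symmetrised bumps `h(x − y) + h(y − x)` gives `(1/N) ∑_{a≠b<N} h(γ̃_a − γ̃_b) → ∫ h w`,
  `w = 1 − K²` (`GUEMontgomery.tendsto_sum_bump_div`); squeezing indicators of boxes between
  bumps (`PairCount.tendsto_card_Icc_div_of_tendsto_sum_smooth`) gives the box statistics in
  the normalisation `γ̃_a − γ̃_b` along the heights `T`; the exchange of normalisations
  (`tendsto_card_logBox_of_normalizedBox`, `ZeroPairExchange.lean`) gives them in Montgomery's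
  normalisation; adding the diagonal (`GUEMontgomery.pairCorrelationCount_eq`) gives (12).
* `(←)` `gueHypothesisAt_one_of_montgomeryPairCorrelation`: subtracting the diagonal and
  exchanging normalisations (`tendsto_card_normalizedBox_of_logBox`) gives the box statistics
  in the normalisation `γ̃_a − γ̃_b`; the Riemann-sum lemma
  (`PairCount.tendsto_sum_div_of_tendsto_card_Icc_div`) upgrades them to continuous compactly
  supported test functions; the tail bound `PairCount.sum_inv_sq_filter_lt_le` with the decay
  `|f(0, u)| ≪ (1 + |u|)⁻²` of the Schwartz slice and the a-priori bound on `1`-close pairs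
  handles the tails of the slice `g(u) = f(0, u)`; this is Rudnick–Sarnak's Theorem-1.2-type
  limit along the heights `T`, and `IsRSTestFunction.tendsto_levelCorrelationSum_div`
  (`RudnickSarnakProofs.lean`) passes to all `N`.

All zero input is the tree's proved Riemann–von Mangoldt formula and `γ₀ > 14`.

## Main results

* `PairCount.tendsto_card_Icc_div_of_tendsto_sum_smooth` (generic).
* `montgomeryPairCorrelation_of_gueHypothesisAt_one`, `gueHypothesisAt_one_of_montgomeryPairCorrelation`.
* `gueHypothesisAt_one_iff_montgomery_holds : gueHypothesisAt_one_iff_montgomery`.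

## References

* Z. Rudnick, P. Sarnak, *Zeros of principal `L`-functions and random matrix theory*, Duke Math.
  J. 81 (1996), 269–322: §1, TF1–TF3 (p. 270), (1.3), (1.5), Thm 1.2 and Remark 1 (p. 273).
* H. L. Montgomery, *The pair correlation of zeros of the zeta function*, Proc. Sympos. Pure
  Math. 24 (1973), 181–193, §1, (12).
* E. C. Titchmarsh, *The Theory of the Riemann Zeta-Function*, 2nd ed. (1986), §14.34.
* N. M. Katz, P. Sarnak, *Zeroes of zeta functions and symmetry*, Bull. AMS 36 (1999), §1.
-/

noncomputable section

open Finset Filter Topology MeasureTheory Complex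
open scoped Real ContDiff

namespace Literature.NumberTheory.LFunctions

namespace PairCount

/-- **From smooth test functions to boxes.** If `(∑_{k ∈ S i} h(d i k)) / n i → ∫ h w` for
every smooth compactly supported `h : ℝ → ℝ` (`0 ≤ w ≤ 1` continuous, `n i > 0` eventually),
then `#{k : d i k ∈ [α, β]} / n i → ∫_α^β w` for all `α < β` (squeeze the indicator between
the bumps of `exists_smooth_ge_indicator_Icc` / `exists_smooth_le_indicator_Icc`; the squeezed
integrals are within `2ε` of `∫_α^β w`). [folklore] -/
theorem tendsto_card_Icc_div_of_tendsto_sum_smooth {ι κ : Type*} {l : Filter ι}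
    (S : ι → Finset κ) (d : ι → κ → ℝ) (n : ι → ℝ) (hn : ∀ᶠ i in l, 0 < n i)
    {w : ℝ → ℝ} (hw : Continuous w) (hw0 : ∀ x, 0 ≤ w x) (hw1 : ∀ x, w x ≤ 1)
    (hsmooth : ∀ h : ℝ → ℝ, ContDiff ℝ ∞ h → HasCompactSupport h →
      Tendsto (fun i ↦ (∑ k ∈ S i, h (d i k)) / n i) l (𝓝 (∫ x, h x * w x)))
    {α β : ℝ} (hαβ : α < β) :
    Tendsto (fun i ↦ (((S i).filter fun k ↦ d i k ∈ Set.Icc α β).card : ℝ) / n i) l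
      (𝓝 (∫ x in α..β, w x)) := by
  classical
  rw [Metric.tendsto_nhds]
  intro ε hε
  set ε' : ℝ := min (ε / 3) ((β - α) / 4) with hε'
  have hε'0 : 0 < ε' := by positivity
  have hε'1 : ε' ≤ ε / 3 := min_le_left _ _
  have hε'2 : ε' ≤ (β - α) / 4 := min_le_right _ _
  obtain ⟨hp, hps, hpc, hp0, hp1, hpone, hpzero⟩ := exists_smooth_ge_indicator_Icc hαβ.le hε'0
  obtain ⟨hm, hms, hmc, hm0, hm1, hmone, hmzero⟩ :=
    exists_smooth_le_indicator_Icc (α := α) (β := β) (ε := ε') (by linarith) hε'0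
  -- the squeezed integrals
  have hIup : ∫ x, hp x * w x ≤ (∫ x in α..β, w x) + 2 * ε' := by
    have h1 := integral_mul_le_intervalIntegral (a' := α - ε') (b' := β + ε') (by linarith)
      hp1 hpzero hw0 hw
    have h2 := intervalIntegral_le_intervalIntegral_add hw hw1 (a' := α - ε') (a := α)
      (b := β) (b' := β + ε') (by linarith) (by linarith)
    linarith
  have hIlow : (∫ x in α..β, w x) - 2 * ε' ≤ ∫ x, hm x * w x := by
    have h1 := intervalIntegral_le_integral_mul (a := α + ε') (b := β - ε') (by linarith)
      hm0 hmone hw0 ((hms.continuous.mul hw).integrable_of_hasCompactSupport hmc.mul_right)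
    have h2 := intervalIntegral_le_intervalIntegral_add hw hw1 (a' := α) (a := α + ε')
      (b := β - ε') (b' := β) (by linarith) (by linarith)
    linarith
  -- pointwise squeeze of the indicator
  have hind_le : ∀ i, (((S i).filter fun k ↦ d i k ∈ Set.Icc α β).card : ℝ) ≤
      ∑ k ∈ S i, hp (d i k) := by
    intro i
    rw [Finset.card_filter, Nat.cast_sum]
    refine Finset.sum_le_sum fun k _ ↦ ?_
    split_ifs with h
    · rw [Nat.cast_one, hpone _ h]
    · rw [Nat.cast_zero]; exact hp0 _
  have hle_ind : ∀ i, ∑ k ∈ S i, hm (d i k) ≤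
      (((S i).filter fun k ↦ d i k ∈ Set.Icc α β).card : ℝ) := by
    intro i
    rw [Finset.card_filter, Nat.cast_sum]
    refine Finset.sum_le_sum fun k _ ↦ ?_
    split_ifs with h
    · rw [Nat.cast_one]; exact hm1 _
    · rw [Nat.cast_zero, hmzero _ fun h' ↦ h (Set.Ioo_subset_Icc_self h')]
  have hup := (tendsto_order.1 (hsmooth hp hps hpc)).2 ((∫ x, hp x * w x) + ε') (by linarith)
  have hlow := (tendsto_order.1 (hsmooth hm hms hmc)).1 ((∫ x, hm x * w x) - ε') (by linarith)
  filter_upwards [hn, hup, hlow] with i hni hupi hlowi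
  rw [Real.dist_eq, abs_lt]
  constructor
  · have h1 : (∑ k ∈ S i, hm (d i k)) / n i ≤
        (((S i).filter fun k ↦ d i k ∈ Set.Icc α β).card : ℝ) / n i :=
      div_le_div_of_nonneg_right (hle_ind i) hni.le
    linarith
  · have h1 : (((S i).filter fun k ↦ d i k ∈ Set.Icc α β).card : ℝ) / n i ≤
        (∑ k ∈ S i, hp (d i k)) / n i :=
      div_le_div_of_nonneg_right (hind_le i) hni.le
    linarith

end PairCount

/-! ## `(→)` GUE(2-level) implies Montgomery's pair correlation conjecture -/

/-- **`GUEHypothesisAt 1 → MontgomeryPairCorrelation`.** [cite: RudnickSarnak1996, §1 Remark 1] -/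
theorem montgomeryPairCorrelation_of_gueHypothesisAt_one (hG : GUEHypothesisAt 1) :
    MontgomeryPairCorrelation := by
  classical
  intro α β hαβ
  have hw := PairCorrelationSmallGaps.continuous_sineGap
  have hw0 := GUEMontgomery.pairDensity_nonneg
  have hw1 := GUEMontgomery.pairDensity_le_one
  have hN : Tendsto zetaZeroCount atTop atTop :=
    riemann_von_mangoldt_holds.tendsto_zetaZeroCount_atTop
  -- box statistics in the normalisation `γ̃_a - γ̃_b`, along the heights
  have hGbox : ∀ α' β' : ℝ, α' < β' → Tendsto (fun T : ℝ ↦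
      ((((Finset.range (zetaZeroCount T)).offDiag).filter fun p : ℕ × ℕ ↦
        normalizedOrdinate p.1 - normalizedOrdinate p.2 ∈ Set.Icc α' β').card : ℝ) /
        zetaZeroCount T) atTop (𝓝 (∫ x in α'..β', (1 - sineKernel x ^ 2))) := by
    intro α' β' hαβ'
    refine PairCount.tendsto_card_Icc_div_of_tendsto_sum_smooth
      (fun T ↦ (Finset.range (zetaZeroCount T)).offDiag)
      (fun _ p ↦ normalizedOrdinate p.1 - normalizedOrdinate p.2)
      (fun T ↦ (zetaZeroCount T : ℝ)) eventually_natCast_zetaZeroCount_pos hw hw0 hw1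
      (fun h hh hhs ↦ ?_) hαβ'
    exact (GUEMontgomery.tendsto_sum_bump_div hG hh hhs).comp hN
  -- box statistics in Montgomery's normalisation
  have hTbox := fun α' β' (h : α' < β') ↦ tendsto_card_logBox_of_normalizedBox hw hw0 hw1 hGbox h
  -- add the diagonal
  have hev : ∀ᶠ T : ℝ in atTop, (pairCorrelationCount α β T : ℝ) / zetaZeroCount T =
      ((((Finset.range (zetaZeroCount T)).offDiag).filter fun p : ℕ × ℕ ↦
        (zetaOrdinate p.1 - zetaOrdinate p.2) * Real.log T / (2 * π) ∈ Set.Icc α β).card : ℝ) /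
        zetaZeroCount T + (if (0 : ℝ) ∈ Set.Icc α β then 1 else 0) := by
    filter_upwards [Real.tendsto_log_atTop.eventually_gt_atTop 0,
      eventually_natCast_zetaZeroCount_pos] with T hT hNT
    rw [GUEMontgomery.pairCorrelationCount_eq hT, add_div]
    congr 1
    split_ifs
    · exact div_self hNT.ne'
    · exact zero_div _
  exact ((hTbox α β hαβ).add_const _).congr' (hev.mono fun T hT ↦ hT.symm)

/-! ## `(←)` Montgomery's pair correlation conjecture implies GUE(2-level) -/

/-- Montgomery's conjecture with the diagonal removed: for `α < β`, the off-diagonal pairs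
`a ≠ b < N(T)` with `(γ_a − γ_b) log T / 2π ∈ [α, β]`, divided by `N(T)`, tend to
`∫_α^β (1 − K²)` (`GUEMontgomery.pairCorrelationCount_eq`). [cite: Montgomery1973, §1 Conjecture (12)] -/
theorem MontgomeryPairCorrelation.tendsto_card_logBox (hM : MontgomeryPairCorrelation) {α β : ℝ}
    (hαβ : α < β) :
    Tendsto (fun T : ℝ ↦
      ((((Finset.range (zetaZeroCount T)).offDiag).filter fun p : ℕ × ℕ ↦
        (zetaOrdinate p.1 - zetaOrdinate p.2) * Real.log T / (2 * π) ∈ Set.Icc α β).card : ℝ) /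
        zetaZeroCount T) atTop (𝓝 (∫ x in α..β, (1 - sineKernel x ^ 2))) := by
  classical
  have h := (hM α β hαβ).sub_const (if (0 : ℝ) ∈ Set.Icc α β then (1 : ℝ) else 0)
  rw [add_sub_cancel_right] at h
  refine h.congr' ?_
  filter_upwards [Real.tendsto_log_atTop.eventually_gt_atTop 0,
    eventually_natCast_zetaZeroCount_pos] with T hT hNT
  rw [GUEMontgomery.pairCorrelationCount_eq hT, add_div, add_sub_assoc]
  conv_rhs => rw [← add_zero (_ / _)]
  congr 1
  split_ifs
  · rw [div_self hNT.ne', sub_self]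
  · rw [zero_div, sub_zero]

/-- A-priori bound on `1`-close pairs from the box statistics: if the off-diagonal pairs with
`γ̃_a − γ̃_b ∈ [α, β]` are asymptotically `N(T) ∫_α^β w` with `w ≤ 1`, then for large `T` all
ordered pairs `a, b < N(T)` (diagonal included) with `|γ̃_a − γ̃_b| ≤ 1` number at most
`4 N(T)`. [folklore] -/
theorem eventually_card_abs_normalizedDiff_le_one_le {w : ℝ → ℝ} (hw : Continuous w)
    (hw1 : ∀ x, w x ≤ 1)
    (hGbox : ∀ α β : ℝ, α < β → Tendsto (fun T : ℝ ↦
      ((((Finset.range (zetaZeroCount T)).offDiag).filter fun p : ℕ × ℕ ↦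
        normalizedOrdinate p.1 - normalizedOrdinate p.2 ∈ Set.Icc α β).card : ℝ) /
        zetaZeroCount T) atTop (𝓝 (∫ x in α..β, w x))) :
    ∀ᶠ T : ℝ in atTop,
      ((((Finset.range (zetaZeroCount T)) ×ˢ (Finset.range (zetaZeroCount T))).filter
        fun q : ℕ × ℕ ↦ |normalizedOrdinate q.1 - normalizedOrdinate q.2| ≤ 1).card : ℝ) ≤
        4 * zetaZeroCount T := by
  classical
  have hW : ∫ x in (-1 : ℝ)..1, w x ≤ 2 := by
    have := intervalIntegral.integral_mono_on (by norm_num : (-1 : ℝ) ≤ 1)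
      (hw.intervalIntegrable (μ := volume) _ _) intervalIntegrable_const (fun x _ ↦ hw1 x)
    simp only [intervalIntegral.integral_const, smul_eq_mul, mul_one] at this
    linarith
  have hev := (tendsto_order.1 (hGbox (-1) 1 (by norm_num))).2 3 (by linarith)
  filter_upwards [hev, eventually_natCast_zetaZeroCount_pos] with T hT hNT
  rw [div_lt_iff₀ hNT] at hT
  set s := Finset.range (zetaZeroCount T) with hs
  have hsplit : ((s ×ˢ s).filter fun q : ℕ × ℕ ↦
      |normalizedOrdinate q.1 - normalizedOrdinate q.2| ≤ 1) ⊆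
      s.diag ∪ (s.offDiag.filter fun p : ℕ × ℕ ↦
        normalizedOrdinate p.1 - normalizedOrdinate p.2 ∈ Set.Icc (-1) 1) := by
    intro q hq
    rw [Finset.mem_filter, Finset.mem_product] at hq
    rw [Finset.mem_union, Finset.mem_diag, Finset.mem_filter, Finset.mem_offDiag, Set.mem_Icc]
    by_cases h : q.1 = q.2
    · exact Or.inl ⟨hq.1.1, h⟩
    · exact Or.inr ⟨⟨hq.1.1, hq.1.2, h⟩, abs_le.1 hq.2⟩
  have h1 := Finset.card_le_card hsplit
  have h2 := Finset.card_union_le s.diag (s.offDiag.filter fun p : ℕ × ℕ ↦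
    normalizedOrdinate p.1 - normalizedOrdinate p.2 ∈ Set.Icc (-1) 1)
  rw [Finset.diag_card, hs, Finset.card_range] at h2
  have h3 : ((((s ×ˢ s).filter fun q : ℕ × ℕ ↦
      |normalizedOrdinate q.1 - normalizedOrdinate q.2| ≤ 1).card : ℕ) : ℝ) ≤
      (zetaZeroCount T : ℝ) + (((s.offDiag.filter fun p : ℕ × ℕ ↦
        normalizedOrdinate p.1 - normalizedOrdinate p.2 ∈ Set.Icc (-1) 1).card : ℕ) : ℝ) := by
    exact_mod_cast h1.trans h2
  rw [hs] at h3
  linarith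

/-- **The `2`-level limit along the heights from the box statistics.** If the off-diagonal pairs
with `γ̃_a − γ̃_b ∈ [α, β]` are asymptotically `N(T) ∫_α^β (1 − K²)` for all `α < β`, then for
every Rudnick–Sarnak test function `f` of two variables
`levelCorrelationSum 2 f N(T) / N(T) → rsLimit 1 f` as `T → ∞`: the slice `g(u) = f(0, u)` is
Schwartz; truncate it continuously at `|u| ≤ K`, apply the Riemann-sum lemma to the real and
imaginary parts of the truncation, and bound the tails by
`∑_{|γ̃_a − γ̃_b| > K} (1 + |γ̃_a − γ̃_b|)⁻² ≤ (4/K) #{1-close pairs} ≤ 16 N(T)/K` and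
`∫_{|u| > K} |g| → 0`. [cite: RudnickSarnak1996, §1 Remark 1] -/
theorem tendsto_levelCorrelationSum_two_div_of_boxes {f : (Fin 2 → ℝ) → ℂ}
    (hf : IsRSTestFunction 1 f)
    (hGbox : ∀ α β : ℝ, α < β → Tendsto (fun T : ℝ ↦
      ((((Finset.range (zetaZeroCount T)).offDiag).filter fun p : ℕ × ℕ ↦
        normalizedOrdinate p.1 - normalizedOrdinate p.2 ∈ Set.Icc α β).card : ℝ) /
        zetaZeroCount T) atTop (𝓝 (∫ x in α..β, (1 - sineKernel x ^ 2)))) :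
    Tendsto (fun T : ℝ ↦ levelCorrelationSum 2 f (zetaZeroCount T) / (zetaZeroCount T : ℂ))
      atTop (𝓝 (rsLimit 1 f)) := by
  classical
  -- the weight
  obtain ⟨w, hwdef⟩ : ∃ w : ℝ → ℝ, w = fun u ↦ 1 - sineKernel u ^ 2 := ⟨_, rfl⟩
  have hw : Continuous w := hwdef ▸ PairCorrelationSmallGaps.continuous_sineGap
  have hw0 : ∀ u, 0 ≤ w u := fun u ↦ hwdef ▸ GUEMontgomery.pairDensity_nonneg u
  have hw1 : ∀ u, w u ≤ 1 := fun u ↦ hwdef ▸ GUEMontgomery.pairDensity_le_one u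
  have hGbox' : ∀ α β : ℝ, α < β → Tendsto (fun T : ℝ ↦
      ((((Finset.range (zetaZeroCount T)).offDiag).filter fun p : ℕ × ℕ ↦
        normalizedOrdinate p.1 - normalizedOrdinate p.2 ∈ Set.Icc α β).card : ℝ) /
        zetaZeroCount T) atTop (𝓝 (∫ x in α..β, w x)) := by
    rw [hwdef]; exact hGbox
  -- the slice `g(u) = f(0, u)`: continuity, integrability, decay
  obtain ⟨g, hg⟩ : ∃ g : ℝ → ℂ, g = fun u ↦ f ![0, u] := ⟨_, rfl⟩
  obtain ⟨gS, hgS⟩ := GUEMontgomery.exists_schwartz_slice hf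
  have hgS' : ⇑gS = g := by
    funext u; rw [hgS u, hg]
  have hgc : Continuous g := hgS' ▸ gS.continuous
  have hgi : Integrable g := hgS' ▸ gS.integrable
  obtain ⟨C, hC0, hC⟩ := GUEMontgomery.exists_norm_slice_le hf
  have hCg : ∀ u, ‖g u‖ ≤ C * ((1 + |u|) ^ 2)⁻¹ := fun u ↦ by rw [hg]; exact hC u
  -- the sequence and the limit in terms of `g`
  have hseq : ∀ T : ℝ, levelCorrelationSum 2 f (zetaZeroCount T) =
      ∑ p ∈ (Finset.range (zetaZeroCount T)).offDiag,
        g (normalizedOrdinate p.1 - normalizedOrdinate p.2) := by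
    intro T
    rw [GUEMontgomery.levelCorrelationSum_two]
    have h1 : ∀ p : ℕ × ℕ, f ![normalizedOrdinate p.1, normalizedOrdinate p.2] =
        g (normalizedOrdinate p.2 - normalizedOrdinate p.1) := by
      intro p
      rw [GUEMontgomery.apply_vec_eq_apply_zero_sub hf.diag_invariant, hg]
    simp_rw [h1]
    exact GUEMontgomery.sum_offDiag_swap (Finset.range (zetaZeroCount T))
      (fun a b ↦ g (normalizedOrdinate a - normalizedOrdinate b))
  have hlim : rsLimit 1 f = ∫ u, g u * (w u : ℂ) := by
    rw [GUEMontgomery.rsLimit_one_eq, hg, hwdef]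
  rw [hlim]
  simp_rw [hseq]
  -- the Riemann-sum lemma for real continuous compactly supported test functions
  have hRiem : ∀ φ : ℝ → ℝ, Continuous φ → HasCompactSupport φ →
      Tendsto (fun T : ℝ ↦ (∑ p ∈ (Finset.range (zetaZeroCount T)).offDiag,
        φ (normalizedOrdinate p.1 - normalizedOrdinate p.2)) / (zetaZeroCount T : ℝ)) atTop
        (𝓝 (∫ x, φ x * w x)) := fun φ hφ hφs ↦
    PairCount.tendsto_sum_div_of_tendsto_card_Icc_div
      (fun T ↦ (Finset.range (zetaZeroCount T)).offDiag)
      (fun _ p ↦ normalizedOrdinate p.1 - normalizedOrdinate p.2)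
      (fun T ↦ (zetaZeroCount T : ℝ)) eventually_natCast_zetaZeroCount_pos hw hw0 hw1
      hGbox' hφ hφs
  -- a-priori bound on `1`-close pairs
  have hP1 := eventually_card_abs_normalizedDiff_le_one_le hw hw1 hGbox'
  -- tail of the integral of `|g|`
  have htailI : Tendsto (fun K : ℕ ↦ ∫ u in {u : ℝ | (K : ℝ) < |u|}, ‖g u‖) atTop (𝓝 0) := by
    have hmeas : ∀ K : ℕ, MeasurableSet {u : ℝ | (K : ℝ) < |u|} := fun K ↦
      measurableSet_lt measurable_const continuous_abs.measurable
    have hanti : Antitone fun K : ℕ ↦ {u : ℝ | (K : ℝ) < |u|} := by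
      intro K K' hKK' u hu
      simp only [Set.mem_setOf_eq] at hu ⊢
      exact lt_of_le_of_lt (Nat.cast_le.2 hKK') hu
    have h := tendsto_setIntegral_of_antitone (μ := volume) (f := fun u ↦ ‖g u‖) hmeas hanti
      ⟨0, hgi.norm.integrableOn⟩
    have hempty : (⋂ K : ℕ, {u : ℝ | (K : ℝ) < |u|}) = ∅ := by
      ext u
      simp only [Set.mem_iInter, Set.mem_setOf_eq, Set.mem_empty_iff_false, iff_false, not_forall,
        not_lt]
      exact exists_nat_ge |u|
    rwa [hempty, Measure.restrict_empty, integral_zero_measure] at h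
  -- ### the `ε`-argument
  rw [Metric.tendsto_nhds]
  intro ε hε
  obtain ⟨K₁, hK₁⟩ := eventually_atTop.1 ((tendsto_order.1 htailI).2 (ε / 4) (by positivity))
  obtain ⟨K₂, hK₂⟩ := exists_nat_gt (64 * C / ε)
  obtain ⟨K, hKdef⟩ : ∃ K : ℕ, K = max (max K₁ K₂) 1 := ⟨_, rfl⟩
  have hK1 : 1 ≤ K := by rw [hKdef]; exact le_max_right _ _
  have hKK₁ : K₁ ≤ K := by rw [hKdef]; exact le_trans (le_max_left _ _) (le_max_left _ _)
  have hKK₂ : K₂ ≤ K := by rw [hKdef]; exact le_trans (le_max_right _ _) (le_max_left _ _)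
  have hK0 : (0 : ℝ) < K := by exact_mod_cast hK1
  have htailK : ∫ u in {u : ℝ | (K : ℝ) < |u|}, ‖g u‖ < ε / 4 := hK₁ K hKK₁
  have h16 : 16 * C / K < ε / 4 := by
    have hK₂' : (K₂ : ℝ) ≤ K := by exact_mod_cast hKK₂
    rw [div_lt_iff₀ hK0]
    rw [div_lt_iff₀ hε] at hK₂
    nlinarith
  -- the cutoff `χ`
  obtain ⟨χ, hχ⟩ : ∃ χ : ℝ → ℝ, χ = fun u ↦ max 0 (min 1 ((K : ℝ) + 1 - |u|)) := ⟨_, rfl⟩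
  have hχc : Continuous χ := by
    rw [hχ]
    exact continuous_const.max (continuous_const.min (continuous_const.sub continuous_abs))
  have hχ1 : ∀ u : ℝ, χ u ≤ 1 := fun u ↦ by
    rw [hχ]; exact max_le zero_le_one (min_le_left _ _)
  have hχ0 : ∀ u : ℝ, 0 ≤ χ u := fun u ↦ by rw [hχ]; exact le_max_left _ _
  have hχone : ∀ u : ℝ, |u| ≤ (K : ℝ) → χ u = 1 := by
    intro u hu
    rw [hχ]
    simp only
    rw [min_eq_left (by linarith), max_eq_right zero_le_one]
  have hχzero : ∀ u : ℝ, (K : ℝ) + 1 ≤ |u| → χ u = 0 := by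
    intro u hu
    rw [hχ]
    simp only
    rw [max_eq_left]
    exact min_le_of_right_le (by linarith)
  have hχabs : ∀ u : ℝ, |1 - χ u| ≤ 1 := fun u ↦ by
    rw [abs_le]; constructor <;> linarith [hχ0 u, hχ1 u]
  -- the truncated slice `φ = g χ`
  obtain ⟨φ, hφ⟩ : ∃ φ : ℝ → ℂ, φ = fun u ↦ g u * (χ u : ℂ) := ⟨_, rfl⟩
  have hφc : Continuous φ := by rw [hφ]; exact hgc.mul (continuous_ofReal.comp hχc)
  have hφs : HasCompactSupport φ := by
    refine HasCompactSupport.intro (isCompact_closedBall (0 : ℝ) (K + 1)) fun u hu ↦ ?_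
    rw [Metric.mem_closedBall, dist_zero_right, Real.norm_eq_abs, not_le] at hu
    rw [hφ]
    simp [hχzero u hu.le]
  have hφre := hRiem (fun u ↦ (φ u).re) (continuous_re.comp hφc)
    (hφs.comp_left (g := Complex.re) Complex.zero_re)
  have hφim := hRiem (fun u ↦ (φ u).im) (continuous_im.comp hφc)
    (hφs.comp_left (g := Complex.im) Complex.zero_im)
  -- complex limit for `φ`
  have hφwint : Integrable fun u ↦ φ u * (w u : ℂ) :=
    (hφc.mul (continuous_ofReal.comp hw)).integrable_of_hasCompactSupport hφs.mul_right
  have hlimeq : ((∫ x, (φ x).re * w x : ℝ) : ℂ) + ((∫ x, (φ x).im * w x : ℝ) : ℂ) * I =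
      ∫ u, φ u * (w u : ℂ) := by
    have hc1 : Continuous fun x ↦ (φ x).re * w x := (continuous_re.comp hφc).mul hw
    have hc2 : Continuous fun x ↦ (φ x).im * w x := (continuous_im.comp hφc).mul hw
    have hs1 : HasCompactSupport fun x ↦ (φ x).re * w x :=
      (hφs.comp_left (g := Complex.re) Complex.zero_re).mul_right
    have hs2 : HasCompactSupport fun x ↦ (φ x).im * w x :=
      (hφs.comp_left (g := Complex.im) Complex.zero_im).mul_right
    have hi1 : Integrable fun x ↦ (((φ x).re * w x : ℝ) : ℂ) :=
      (hc1.integrable_of_hasCompactSupport hs1).ofReal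
    have hi2 : Integrable fun x ↦ (((φ x).im * w x : ℝ) : ℂ) * I :=
      ((hc2.integrable_of_hasCompactSupport hs2).ofReal).mul_const I
    rw [← integral_complex_ofReal, ← integral_complex_ofReal, ← integral_mul_const,
      ← integral_add hi1 hi2]
    refine integral_congr_ae (ae_of_all _ fun x ↦ ?_)
    simp only
    push_cast
    conv_rhs => rw [← Complex.re_add_im (φ x)]
    ring
  have hφlim : Tendsto (fun T : ℝ ↦ (∑ p ∈ (Finset.range (zetaZeroCount T)).offDiag,
      φ (normalizedOrdinate p.1 - normalizedOrdinate p.2)) / (zetaZeroCount T : ℂ)) atTop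
      (𝓝 (∫ u, φ u * (w u : ℂ))) := by
    have h1 := ((continuous_ofReal.tendsto _).comp hφre).add
      (((continuous_ofReal.tendsto _).comp hφim).mul_const I)
    rw [hlimeq] at h1
    refine h1.congr fun T ↦ ?_
    simp only [Function.comp_apply]
    set z : ℂ := (∑ p ∈ (Finset.range (zetaZeroCount T)).offDiag,
      φ (normalizedOrdinate p.1 - normalizedOrdinate p.2)) / (zetaZeroCount T : ℂ) with hz
    conv_rhs => rw [← Complex.re_add_im z]
    simp only [hz, Complex.div_natCast_re, Complex.div_natCast_im, Complex.re_sum, Complex.im_sum]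
  -- integrability of `g w`
  have hgwint : Integrable fun u ↦ g u * (w u : ℂ) := by
    refine hgi.mul_bdd (c := 1) (continuous_ofReal.comp hw).aestronglyMeasurable
      (ae_of_all _ fun u ↦ ?_)
    simp only [Complex.norm_real, Real.norm_eq_abs]
    rw [abs_le]; constructor <;> linarith [hw0 u, hw1 u]
  -- ### main estimate
  have hφT := (Metric.tendsto_nhds.1 hφlim) (ε / 4) (by positivity)
  filter_upwards [eventually_natCast_zetaZeroCount_pos, hP1, hφT] with T hNT hP1T hφT'
  set s := Finset.range (zetaZeroCount T) with hs
  set d : ℕ × ℕ → ℝ := fun p ↦ normalizedOrdinate p.1 - normalizedOrdinate p.2 with hd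
  have hNC : ((zetaZeroCount T : ℕ) : ℂ) = ((zetaZeroCount T : ℝ) : ℂ) := by norm_cast
  -- (i) the tail of the sum
  have htail_sum : ‖(∑ p ∈ s.offDiag, g (d p)) / (zetaZeroCount T : ℂ) -
      (∑ p ∈ s.offDiag, φ (d p)) / (zetaZeroCount T : ℂ)‖ ≤ 16 * C / K := by
    rw [← sub_div, ← Finset.sum_sub_distrib, norm_div, hNC, Complex.norm_real,
      Real.norm_of_nonneg hNT.le, div_le_iff₀ hNT]
    have hpt : ∀ p : ℕ × ℕ, ‖g (d p) - φ (d p)‖ ≤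
        if (K : ℝ) < |d p| then C * ((1 + |d p|) ^ 2)⁻¹ else 0 := by
      intro p
      have : g (d p) - φ (d p) = g (d p) * ((1 - χ (d p) : ℝ) : ℂ) := by
        rw [hφ]; push_cast; ring
      rw [this, norm_mul, Complex.norm_real, Real.norm_eq_abs]
      split_ifs with h
      · calc ‖g (d p)‖ * |1 - χ (d p)| ≤ C * ((1 + |d p|) ^ 2)⁻¹ * 1 :=
            mul_le_mul (hCg _) (hχabs _) (abs_nonneg _) (by positivity)
          _ = C * ((1 + |d p|) ^ 2)⁻¹ := mul_one _
      · rw [hχone _ (not_lt.1 h), sub_self, abs_zero, mul_zero]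
    calc ‖∑ p ∈ s.offDiag, (g (d p) - φ (d p))‖
        ≤ ∑ p ∈ s.offDiag, ‖g (d p) - φ (d p)‖ := norm_sum_le _ _
      _ ≤ ∑ p ∈ s.offDiag, if (K : ℝ) < |d p| then C * ((1 + |d p|) ^ 2)⁻¹ else 0 :=
          Finset.sum_le_sum fun p _ ↦ hpt p
      _ ≤ ∑ p ∈ s ×ˢ s, if (K : ℝ) < |d p| then C * ((1 + |d p|) ^ 2)⁻¹ else 0 := by
          refine Finset.sum_le_sum_of_subset_of_nonneg (fun p hp ↦ ?_) fun p _ _ ↦ by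
            split_ifs <;> positivity
          rw [Finset.mem_offDiag] at hp
          exact Finset.mem_product.2 ⟨hp.1, hp.2.1⟩
      _ = C * ∑ p ∈ (s ×ˢ s).filter (fun p ↦ (K : ℝ) < |d p|), ((1 + |d p|) ^ 2)⁻¹ := by
          rw [Finset.sum_filter, Finset.mul_sum]
          refine Finset.sum_congr rfl fun p _ ↦ ?_
          split_ifs <;> simp
      _ ≤ C * (4 / K * (((s ×ˢ s).filter fun q : ℕ × ℕ ↦ |d q| ≤ 1).card : ℝ)) := by
          refine mul_le_mul_of_nonneg_left ?_ hC0
          exact PairCount.sum_inv_sq_filter_lt_le s normalizedOrdinate hK1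
      _ ≤ C * (4 / K * (4 * zetaZeroCount T)) := by gcongr
      _ = 16 * C / K * zetaZeroCount T := by ring
  -- (ii) the tail of the integral
  have htail_int : ‖(∫ u, g u * (w u : ℂ)) - ∫ u, φ u * (w u : ℂ)‖ ≤
      ∫ u in {u : ℝ | (K : ℝ) < |u|}, ‖g u‖ := by
    rw [← integral_sub hgwint hφwint, ← integral_indicator
      (measurableSet_lt measurable_const continuous_abs.measurable)]
    refine norm_integral_le_of_norm_le (hgi.norm.indicator
      (measurableSet_lt measurable_const continuous_abs.measurable)) (ae_of_all _ fun u ↦ ?_)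
    have : g u * (w u : ℂ) - φ u * (w u : ℂ) = g u * ((1 - χ u : ℝ) : ℂ) * (w u : ℂ) := by
      rw [hφ]; push_cast; ring
    rw [this, norm_mul, norm_mul, Complex.norm_real, Complex.norm_real, Real.norm_eq_abs,
      Real.norm_eq_abs, abs_of_nonneg (hw0 u)]
    by_cases hu : (K : ℝ) < |u|
    · rw [Set.indicator_of_mem (by exact hu)]
      calc ‖g u‖ * |1 - χ u| * w u ≤ ‖g u‖ * 1 * 1 :=
            mul_le_mul (mul_le_mul_of_nonneg_left (hχabs u) (norm_nonneg _)) (hw1 u) (hw0 u)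
              (by positivity)
        _ = ‖g u‖ := by ring
    · rw [Set.indicator_of_notMem (by exact hu), hχone u (not_lt.1 hu), sub_self, abs_zero,
        mul_zero, zero_mul]
  -- (iii) combine
  rw [dist_eq_norm] at hφT' ⊢
  calc ‖(∑ p ∈ s.offDiag, g (d p)) / (zetaZeroCount T : ℂ) - ∫ u, g u * (w u : ℂ)‖
      ≤ ‖(∑ p ∈ s.offDiag, g (d p)) / (zetaZeroCount T : ℂ) -
            (∑ p ∈ s.offDiag, φ (d p)) / (zetaZeroCount T : ℂ)‖ +
          ‖(∑ p ∈ s.offDiag, φ (d p)) / (zetaZeroCount T : ℂ) - ∫ u, φ u * (w u : ℂ)‖ +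
          ‖(∫ u, φ u * (w u : ℂ)) - ∫ u, g u * (w u : ℂ)‖ := by
        refine le_trans (norm_sub_le_norm_sub_add_norm_sub _
          ((∑ p ∈ s.offDiag, φ (d p)) / (zetaZeroCount T : ℂ)) _) ?_
        linarith [norm_sub_le_norm_sub_add_norm_sub
          ((∑ p ∈ s.offDiag, φ (d p)) / (zetaZeroCount T : ℂ)) (∫ u, φ u * (w u : ℂ))
          (∫ u, g u * (w u : ℂ))]
    _ < ε / 4 + ε / 4 + ε / 4 := by
        gcongr
        · exact htail_sum.trans_lt h16
        · rw [norm_sub_rev]; exact htail_int.trans_lt htailK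
    _ < ε := by linarith

/-- **`MontgomeryPairCorrelation → GUEHypothesisAt 1`.** [cite: RudnickSarnak1996, §1 Remark 1] -/
theorem gueHypothesisAt_one_of_montgomeryPairCorrelation (hM : MontgomeryPairCorrelation) :
    GUEHypothesisAt 1 := by
  intro f hf
  have hw := PairCorrelationSmallGaps.continuous_sineGap
  have hw0 := GUEMontgomery.pairDensity_nonneg
  have hw1 := GUEMontgomery.pairDensity_le_one
  have hTbox := fun α β (h : α < β) ↦ hM.tendsto_card_logBox h
  have hGbox := fun α β (h : α < β) ↦ tendsto_card_normalizedBox_of_logBox hw hw0 hw1 hTbox h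
  exact hf.tendsto_levelCorrelationSum_div (tendsto_levelCorrelationSum_two_div_of_boxes hf hGbox)

/-! ## The equivalence -/

/-- **Discharge of `Literature.NumberTheory.LFunctions.gueHypothesisAt_one_iff_montgomery`**
(`ZeroStatistics.lean`): the `2`-level GUE hypothesis (Rudnick–Sarnak 1996, §1 Remark 1 with
`n = 2`: all test functions TF1–TF3 of two variables, `N`-indexed, `γ̃ = γ log γ / 2π`) is
equivalent to Montgomery's pair correlation conjecture (Montgomery 1973, (12), `N(T)`-normalised
closed windows in the scale `log T / 2π`, Titchmarsh–Heath-Brown §14.34). Rudnick–Sarnak,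
p. 273: "In the case of `ζ(s)` and `n = 2`, Theorem 1.2 coincides with the result of
Montgomery." [cite: RudnickSarnak1996, §1 Remark 1] -/
theorem gueHypothesisAt_one_iff_montgomery_holds : gueHypothesisAt_one_iff_montgomery :=
  ⟨montgomeryPairCorrelation_of_gueHypothesisAt_one, gueHypothesisAt_one_of_montgomeryPairCorrelation⟩

end Literature.NumberTheory.LFunctions

end
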